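import Mathlib.Analysis.MeanInequalities
import Mathlib.Analysis.SpecialFunctions.ImproperIntegrals
import Mathlib.Analysis.SpecialFunctions.Trigonometric.Series
import Mathlib.Analysis.SpecialFunctions.Trigonometric.DerivHyp
import Mathlib.Analysis.SpecialFunctions.Complex.LogBounds
import Mathlib.MeasureTheory.Group.Integral
import Mathlib.MeasureTheory.Integral.Bochner.ContinuousLinearMap
import Mathlib.MeasureTheory.Integral.DominatedConvergence
import Mathlib.MeasureTheory.Measure.Lebesgue.Integral
import Literature.Analysis.Complex.DeBruijnUniversalFactors
import Literature.Analysis.Complex.LaguerrePolya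
import HarnessLib

/-!
# de Bruijn's universal factor `e^{λ²t²/2}` (de Bruijn 1950, Thms. 10 and 13 for `Δ = 0`) — proofs

Trunk T-ANT support (complex analysis), companion ("Proofs") file of
`Literature/Analysis/Complex/DeBruijnUniversalFactors.lean`, on the way to the discharge of
`Literature.NumberTheory.LFunctions.HasOnlyRealZeros.mono_deBruijnH` (`Literature/NumberTheory/LFunctions/DeBruijnNewman.lean`).

## Contents (all proved)

* `Literature.Analysis.Complex.DeBruijn1950.thm10_holds` — **discharge of the named fact `DeBruijn1950.thm10`**
  (de Bruijn 1950, Thm. 10; Pólya 1927): for an admissible kernel `F` (integrable,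
  `F(−t) = F(t)^*`, `F = O(e^{−|t|^b})` with `b > 2`) the trigonometric integral
  `f(z) = ∫ F(t) e^{izt} dt` is a real entire function of order `< 2`
  (Young's inequality `|z||t| ≤ |z|^{b'}/b' + |t|^b/b`, `b' = b/(b−1) < 2`).
* `Literature.Analysis.Complex.DeBruijn1950.iterate_shift_trigIntegral` — de Bruijn's identity behind Thms. 11–13:
  `∑ₖ (M choose k) f(z + (2k−M) iμ) = ∫ F(t) (2 cosh μt)^M e^{izt} dt`.
* `Literature.Analysis.Complex.DeBruijn1950.tendsto_cosh_div_pow_sq`, `Literature.Analysis.Complex.DeBruijn1950.cosh_div_pow_sq_le`: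
  `cosh(x/N)^{N²} → e^{x²/2}` monotonically dominated by `e^{x²/2}` (de Bruijn's (3.9) with
  `βₙ = 1/N`).
* `Literature.Analysis.Complex.DeBruijn1950.tendstoLocallyUniformly_trigIntegral`: dominated convergence of kernels gives
  locally uniform convergence of the trigonometric integrals.
* `Literature.Analysis.Complex.DeBruijn1950.rootsInStrip_zero_gaussian` — **de Bruijn 1950, Thm. 13 for `Δ = 0`**
  (with the harmless extra hypothesis that the target function is `≢ 0`, automatic in
  applications): if `F` is admissible and `∫ F(t) e^{izt} dt` has only real zeros, then so has
  `∫ F(t) e^{λ²t²/2} e^{izt} dt`. The proof follows de Bruijn (approximate `e^{λ²t²/2}` by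
  `cosh(λt/N)^{N²}`, i.e. apply the shift operator `N²` times with step `λ/N`, then Hurwitz),
  except that the real-rootedness of each shift (his Thm. 8, via Thm. 6 = Hadamard
  factorisation) is taken from the Hadamard-free `Literature.Analysis.Complex.deBruijn_iterate_shift_dichotomy`.

## References

* N. G. de Bruijn, *The roots of trigonometric integrals*, Duke Math. J. 17 (1950), 197–226,
  Thms. 8, 10, 11, 12, 13 and formulas (3.4)–(3.9).
* G. Pólya, *Über trigonometrische Integrale mit nur reellen Nullstellen*, J. reine angew. Math.
  158 (1927), 6–18.
-/

noncomputable section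

open Complex MeasureTheory Filter Metric Set Topology

/-! ## Proof of de Bruijn's Theorem 10 (Pólya): order `< 2` and realness of `trigIntegral F` -/

namespace Literature.Analysis.Complex

namespace DeBruijn1950

open Real in
/-- `t ↦ e^{−|t|}` is integrable on `ℝ`. [folklore] -/
theorem integrable_exp_neg_abs : Integrable fun t : ℝ ↦ Real.exp (-|t|) := by
  have hIoi : IntegrableOn (fun t : ℝ ↦ Real.exp (-|t|)) (Ioi 0) :=
    (integrableOn_exp_neg_Ioi 0).congr_fun (fun t ht ↦ by
      rw [abs_of_pos (show (0 : ℝ) < t from ht)]) measurableSet_Ioi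
  have hIic : IntegrableOn (fun t : ℝ ↦ Real.exp (-|t|)) (Iic 0) := by
    rw [← Measure.map_neg_eq_self (volume : Measure ℝ)]
    let m : MeasurableEmbedding fun x : ℝ ↦ -x := (Homeomorph.neg ℝ).measurableEmbedding
    rw [m.integrableOn_map_iff]
    simp_rw [Function.comp_def, abs_neg, neg_preimage, neg_Iic, neg_zero]
    exact Iff.mpr integrableOn_Ici_iff_integrableOn_Ioi hIoi
  have := hIic.union hIoi
  rwa [Iic_union_Ioi, integrableOn_univ] at this

/-- Unpacking an `∀ᶠ t in cocompact ℝ` statement: it holds for `|t| > R`. [folklore] -/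
theorem exists_forall_abs_gt_of_eventually_cocompact {p : ℝ → Prop}
    (h : ∀ᶠ t in cocompact ℝ, p t) : ∃ R : ℝ, 1 ≤ R ∧ ∀ t : ℝ, R < |t| → p t := by
  obtain ⟨K, hK, hsub⟩ := mem_cocompact'.1 h
  obtain ⟨R, hR⟩ := hK.isBounded.subset_closedBall 0
  refine ⟨max R 1, le_max_right _ _, fun t ht ↦ ?_⟩
  by_contra hpt
  have htK : t ∈ K := hsub hpt
  have := hR htK
  rw [mem_closedBall, dist_zero_right, Real.norm_eq_abs] at this
  linarith [le_max_left R 1]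

variable {F : ℝ → ℂ}

/-- The decay hypothesis (3.5) in usable form: `‖F t‖ ≤ C e^{−|t|^b}` for `|t| > R ≥ 1`, with
`b > 2`, `C ≥ 0`. [cite: Bruijn1950, Thm. 10] -/
theorem IsAdmissible.exists_decay (hF : IsAdmissible F) :
    ∃ b C R : ℝ, 2 < b ∧ 0 ≤ C ∧ 1 ≤ R ∧ ∀ t : ℝ, R < |t| → ‖F t‖ ≤ C * Real.exp (-|t| ^ b) := by
  obtain ⟨b, C, hb, hev⟩ := hF.decay
  obtain ⟨R, hR, hRt⟩ := exists_forall_abs_gt_of_eventually_cocompact hev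
  refine ⟨b, max C 0, R, hb, le_max_right _ _, hR, fun t ht ↦ (hRt t ht).trans ?_⟩
  gcongr
  exact le_max_left _ _

/-- Weighted integrability of an admissible kernel: if `w ≥ 0` is continuous and
`e^{−|t|^b} w(t) ≤ e^{K − |t|}` beyond `R`, then `‖F‖ w` is integrable. [folklore] -/
theorem integrable_norm_mul_of_decay (hFi : Integrable F) {b C R : ℝ} (hC : 0 ≤ C)
    (hdecay : ∀ t : ℝ, R < |t| → ‖F t‖ ≤ C * Real.exp (-|t| ^ b))
    {w : ℝ → ℝ} (hw : Continuous w) (hw0 : ∀ t, 0 ≤ w t) {K : ℝ}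
    (htail : ∀ t : ℝ, R < |t| → Real.exp (-|t| ^ b) * w t ≤ Real.exp (K - |t|)) :
    Integrable fun t : ℝ ↦ ‖F t‖ * w t := by
  -- bound `w` on `[-R, R]`
  obtain ⟨M, hM⟩ := (isCompact_closedBall (0 : ℝ) R).exists_bound_of_continuousOn hw.continuousOn
  set M' : ℝ := max M 0 with hM'
  have hg : Integrable fun t : ℝ ↦ ‖F t‖ * M' + C * (Real.exp K * Real.exp (-|t|)) :=
    (hFi.norm.mul_const M').add ((integrable_exp_neg_abs.const_mul _).const_mul C)
  refine hg.mono' (hFi.aestronglyMeasurable.norm.mul hw.aestronglyMeasurable)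
    (Eventually.of_forall fun t ↦ ?_)
  rw [Real.norm_eq_abs, abs_of_nonneg (mul_nonneg (norm_nonneg _) (hw0 t))]
  have h2 : 0 ≤ C * (Real.exp K * Real.exp (-|t|)) := by positivity
  have h1 : 0 ≤ ‖F t‖ * M' := by positivity
  rcases le_or_gt |t| R with ht | ht
  · have hwt : w t ≤ M' := by
      have := hM t (by rw [mem_closedBall, dist_zero_right, Real.norm_eq_abs]; exact ht)
      rw [Real.norm_eq_abs] at this
      exact (le_abs_self _).trans (this.trans (le_max_left _ _))
    calc ‖F t‖ * w t ≤ ‖F t‖ * M' := by gcongr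
      _ ≤ ‖F t‖ * M' + C * (Real.exp K * Real.exp (-|t|)) := le_add_of_nonneg_right h2
  · calc ‖F t‖ * w t ≤ C * Real.exp (-|t| ^ b) * w t := by gcongr; exacts [hw0 t, hdecay t ht]
      _ = C * (Real.exp (-|t| ^ b) * w t) := by ring
      _ ≤ C * Real.exp (K - |t|) := by gcongr; exact htail t ht
      _ = C * (Real.exp K * Real.exp (-|t|)) := by rw [sub_eq_add_neg, Real.exp_add]
      _ ≤ _ := le_add_of_nonneg_left h1

/-- For `|t| ≥ 1` and `b ≥ 2`: `t² ≤ |t|^b`. [folklore] -/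
theorem sq_le_abs_rpow {t b : ℝ} (ht : 1 ≤ |t|) (hb : 2 ≤ b) : t ^ 2 ≤ |t| ^ b := by
  calc t ^ 2 = |t| ^ (2 : ℝ) := by rw [Real.rpow_two, sq_abs]
    _ ≤ |t| ^ b := Real.rpow_le_rpow_of_exponent_le ht hb

/-- **All exponential moments of an admissible kernel are finite**: `∫ ‖F(t)‖ e^{c|t|} dt < ∞`.
[cite: Bruijn1950, Thm. 10] -/
theorem IsAdmissible.integrable_norm_mul_exp (hF : IsAdmissible F) (c : ℝ) :
    Integrable fun t : ℝ ↦ ‖F t‖ * Real.exp (c * |t|) := by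
  obtain ⟨b, C, R, hb, hC, hR, hdecay⟩ := hF.exists_decay
  refine integrable_norm_mul_of_decay hF.integrable hC hdecay (by fun_prop)
    (fun t ↦ (Real.exp_pos _).le) (K := (c + 1) ^ 2 / 4) fun t ht ↦ ?_
  rw [← Real.exp_add]
  apply Real.exp_le_exp.2
  have h1 : t ^ 2 ≤ |t| ^ b := sq_le_abs_rpow (by linarith) hb.le
  nlinarith [sq_nonneg (|t| - (c + 1) / 2), sq_abs t]

/-- The Young-weight moment: `∫ ‖F(t)‖ e^{|t|^b / b} dt < ∞` for the decay exponent `b`.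
[cite: Bruijn1950, Thm. 10] -/
theorem integrable_norm_mul_exp_rpow (hFi : Integrable F) {b C R : ℝ} (hb : 2 < b) (hC : 0 ≤ C)
    (hR : 1 ≤ R) (hdecay : ∀ t : ℝ, R < |t| → ‖F t‖ ≤ C * Real.exp (-|t| ^ b)) :
    Integrable fun t : ℝ ↦ ‖F t‖ * Real.exp (|t| ^ b / b) := by
  have hb0 : 0 < b := by linarith
  refine integrable_norm_mul_of_decay hFi hC hdecay
    (by
      have : Continuous fun t : ℝ ↦ |t| ^ b := by
        refine Continuous.rpow_const continuous_abs fun t ↦ Or.inr hb0.le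
      fun_prop)
    (fun t ↦ (Real.exp_pos _).le) (K := 1 / 2) fun t ht ↦ ?_
  rw [← Real.exp_add]
  apply Real.exp_le_exp.2
  have h1 : t ^ 2 ≤ |t| ^ b := sq_le_abs_rpow (by linarith) hb.le
  have h2 : (1 : ℝ) / 2 ≤ 1 - 1 / b := by
    rw [div_le_iff₀ (by norm_num : (0 : ℝ) < 2)]
    have : 1 / b ≤ 1 / 2 := one_div_le_one_div_of_le (by norm_num) hb.le
    linarith
  have h3 : 0 ≤ |t| ^ b := Real.rpow_nonneg (abs_nonneg t) b
  have h4 : -|t| ^ b + |t| ^ b / b = -((1 - 1 / b) * |t| ^ b) := by ring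
  rw [h4]
  nlinarith [sq_nonneg (|t| - 1), sq_abs t, mul_le_mul_of_nonneg_right h2 h3]

/-- The basic bound `‖f(z)‖ ≤ ∫ ‖F(t)‖ e^{‖z‖ |t|} dt`. [cite: Bruijn1950, Thm. 10] -/
theorem norm_trigIntegral_le (hF : IsAdmissible F) (z : ℂ) :
    ‖trigIntegral F z‖ ≤ ∫ t : ℝ, ‖F t‖ * Real.exp (‖z‖ * |t|) := by
  refine norm_integral_le_of_norm_le (hF.integrable_norm_mul_exp ‖z‖)
    (Eventually.of_forall fun t ↦ ?_)
  rw [norm_mul]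
  gcongr
  exact norm_cexp_I_mul_mul_le z t

/-- **Order `< 2`** (de Bruijn 1950, Thm. 10; Pólya): with `b > 2` the decay exponent and
`b' = b/(b−1) < 2` its conjugate, Young's inequality `‖z‖|t| ≤ ‖z‖^{b'}/b' + |t|^b/b` gives
`‖f(z)‖ ≤ (∫ ‖F‖ e^{|t|^b/b}) · e^{‖z‖^{b'}}`. [cite: Bruijn1950, Thm. 10] -/
theorem IsAdmissible.exists_order_bound (hF : IsAdmissible F) :
    ∃ ρ C₀ : ℝ, 0 ≤ ρ ∧ ρ < 2 ∧ ∀ z : ℂ, ‖trigIntegral F z‖ ≤ C₀ * Real.exp (‖z‖ ^ ρ) := by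
  obtain ⟨b, C, R, hb, hC, hR, hdecay⟩ := hF.exists_decay
  have hb1 : 1 < b := by linarith
  have hconj : b.HolderConjugate (Real.conjExponent b) := Real.HolderConjugate.conjExponent hb1
  set b' : ℝ := Real.conjExponent b with hb'
  have hb'lt : b' < 2 := by
    rw [hb', Real.conjExponent, div_lt_iff₀ (by linarith)]; linarith
  have hb'gt : 1 < b' := hconj.symm.lt
  have hI := integrable_norm_mul_exp_rpow hF.integrable hb hC hR hdecay
  set C₀ : ℝ := ∫ t : ℝ, ‖F t‖ * Real.exp (|t| ^ b / b) with hC₀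
  have hC₀ : 0 ≤ C₀ := integral_nonneg fun t ↦ by positivity
  refine ⟨b', C₀, by linarith, hb'lt, fun z ↦ ?_⟩
  have hyoung : ∀ t : ℝ, ‖z‖ * |t| ≤ ‖z‖ ^ b' / b' + |t| ^ b / b := fun t ↦
    Real.young_inequality_of_nonneg (norm_nonneg z) (abs_nonneg t) hconj.symm
  calc ‖trigIntegral F z‖ ≤ ∫ t : ℝ, ‖F t‖ * Real.exp (‖z‖ * |t|) := norm_trigIntegral_le hF z
    _ ≤ ∫ t : ℝ, Real.exp (‖z‖ ^ b' / b') * (‖F t‖ * Real.exp (|t| ^ b / b)) := by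
        refine integral_mono (hF.integrable_norm_mul_exp ‖z‖) (hI.const_mul _) fun t ↦ ?_
        dsimp only
        calc ‖F t‖ * Real.exp (‖z‖ * |t|) ≤ ‖F t‖ * Real.exp (‖z‖ ^ b' / b' + |t| ^ b / b) := by
              gcongr; exact hyoung t
          _ = _ := by rw [Real.exp_add]; ring
    _ = Real.exp (‖z‖ ^ b' / b') * C₀ := integral_const_mul _ _
    _ ≤ Real.exp (‖z‖ ^ b') * C₀ := by
        gcongr
        have h0 : 0 ≤ ‖z‖ ^ b' := Real.rpow_nonneg (norm_nonneg z) b'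
        rw [div_le_iff₀ (by linarith)]
        nlinarith
    _ = C₀ * Real.exp (‖z‖ ^ b') := mul_comm _ _

/-- **Realness** (de Bruijn 1950, Thm. 10): `F(−t) = F(t)^*` makes `f = ∫ F(t) e^{izt} dt` real on
the real axis. [cite: Bruijn1950, Thm. 10] -/
theorem isRealOnReal_trigIntegral (hsymm : ∀ t : ℝ, F (-t) = (starRingEnd ℂ) (F t)) :
    IsRealOnReal (trigIntegral F) := by
  intro x
  rw [← Complex.conj_eq_iff_im, trigIntegral, ← integral_conj]
  have h : (fun t : ℝ ↦ (starRingEnd ℂ) (F t * Complex.exp (I * x * t))) =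
      fun t : ℝ ↦ F (-t) * Complex.exp (I * x * ((-t : ℝ) : ℂ)) := by
    funext t
    rw [map_mul, ← hsymm, ← Complex.exp_conj]
    congr 2
    simp only [map_mul, Complex.conj_I, Complex.conj_ofReal, Complex.ofReal_neg]
    ring
  rw [h]
  exact integral_neg_eq_self (fun t : ℝ ↦ F t * Complex.exp (I * x * t)) volume

/-- **Discharge of the named fact `DeBruijn1950.thm10`** (de Bruijn 1950, Thm. 10; Pólya 1927):
for an admissible kernel `F`, `f(z) = ∫ F(t) e^{izt} dt` is a real entire function of order `< 2`.
[cite: Bruijn1950, Thm. 10] -/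
theorem thm10_holds : thm10 := fun _ hF ↦
  ⟨⟨differentiable_trigIntegral hF.integrable.aestronglyMeasurable hF.integrable_norm_mul_exp,
    let ⟨ρ, C₀, _, hρ, h⟩ := hF.exists_order_bound; ⟨ρ, C₀, hρ, h⟩⟩,
    isRealOnReal_trigIntegral hF.conj_symm⟩

end DeBruijn1950

end Literature.Analysis.Complex

namespace Literature.Analysis.Complex

namespace DeBruijn1950

variable {F : ℝ → ℂ}

/-! ## Gaussian moments of admissible kernels -/

/-- If `A ≥ 0`, `b > 2` and `|t| ≥ A^{1/(b−2)}` then `A t² ≤ |t|^b`. [folklore] -/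
theorem mul_sq_le_abs_rpow {A b t : ℝ} (hA : 0 ≤ A) (hb : 2 < b)
    (ht : A ^ (1 / (b - 2)) ≤ |t|) : A * t ^ 2 ≤ |t| ^ b := by
  have hb2 : 0 < b - 2 := by linarith
  have h0 : 0 ≤ |t| := abs_nonneg t
  have h1 : A ≤ |t| ^ (b - 2) := by
    calc A = (A ^ (1 / (b - 2))) ^ (b - 2) := by
          rw [← Real.rpow_mul hA, one_div_mul_cancel hb2.ne', Real.rpow_one]
      _ ≤ |t| ^ (b - 2) := Real.rpow_le_rpow (Real.rpow_nonneg hA _) ht hb2.le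
  rcases h0.eq_or_lt with h | h
  · rw [← h]
    have : t = 0 := abs_eq_zero.1 h.symm
    simp [this, Real.zero_rpow (by linarith : b ≠ 0)]
  · calc A * t ^ 2 ≤ |t| ^ (b - 2) * t ^ 2 := by gcongr
      _ = |t| ^ (b - 2) * |t| ^ (2 : ℝ) := by rw [Real.rpow_two, sq_abs]
      _ = |t| ^ b := by rw [← Real.rpow_add h]; ring_nf

/-- **Gaussian-exponential moments of an admissible kernel are finite**:
`∫ ‖F(t)‖ e^{a t²} e^{c|t|} dt < ∞` for all real `a`, `c` (because `b > 2` in (3.5)).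
[cite: Bruijn1950, Thm. 13] -/
theorem IsAdmissible.integrable_norm_mul_gaussian (hF : IsAdmissible F) (a c : ℝ) :
    Integrable fun t : ℝ ↦ ‖F t‖ * (Real.exp (a * t ^ 2) * Real.exp (c * |t|)) := by
  obtain ⟨b, C, R, hb, hC, hR, hdecay⟩ := hF.exists_decay
  set A : ℝ := |a| + 1 with hA
  have hA0 : 0 ≤ A := by positivity
  set R' : ℝ := max R (A ^ (1 / (b - 2))) with hR'
  have hdecay' : ∀ t : ℝ, R' < |t| → ‖F t‖ ≤ C * Real.exp (-|t| ^ b) := fun t ht ↦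
    hdecay t ((le_max_left _ _).trans_lt ht)
  refine integrable_norm_mul_of_decay hF.integrable hC hdecay' (by fun_prop)
    (fun t ↦ by positivity) (K := (c + 1) ^ 2 / 4) fun t ht ↦ ?_
  rw [← Real.exp_add, ← Real.exp_add]
  apply Real.exp_le_exp.2
  have h1 : A * t ^ 2 ≤ |t| ^ b := mul_sq_le_abs_rpow hA0 hb ((le_max_right _ _).trans ht.le)
  have h2 : a * t ^ 2 ≤ |a| * t ^ 2 := mul_le_mul_of_nonneg_right (le_abs_self a) (sq_nonneg t)
  nlinarith [sq_nonneg (|t| - (c + 1) / 2), sq_abs t]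

/-! ## The shift operator on trigonometric integrals: `(2 cosh μt)^M` -/

/-- `cosh x ≤ e^{|x|}`. [folklore] -/
theorem cosh_le_exp_abs (x : ℝ) : Real.cosh x ≤ Real.exp |x| := by
  rw [Real.cosh_eq]
  have h1 : Real.exp x ≤ Real.exp |x| := Real.exp_le_exp.2 (le_abs_self x)
  have h2 : Real.exp (-x) ≤ Real.exp |x| := Real.exp_le_exp.2 (neg_le_abs x)
  linarith

/-- The kernel `F(t) (2 cosh μt)^M` keeps finite exponential moments. [folklore] -/
theorem integrable_norm_mul_pow_cosh_mul_exp (hFm : AEStronglyMeasurable F)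
    (hexp : ∀ c : ℝ, Integrable fun t ↦ ‖F t‖ * Real.exp (c * |t|)) (μ : ℝ) (M : ℕ) (c : ℝ) :
    Integrable fun t : ℝ ↦
      ‖F t * (((2 * Real.cosh (μ * t)) ^ M : ℝ) : ℂ)‖ * Real.exp (c * |t|) := by
  have hmaj := (hexp (M * |μ| + c)).const_mul ((2 : ℝ) ^ M)
  refine hmaj.mono' ((hFm.mul (by fun_prop)).norm.mul (by fun_prop))
    (Eventually.of_forall fun t ↦ ?_)
  have hcosh : 0 < Real.cosh (μ * t) := Real.cosh_pos _
  rw [Real.norm_eq_abs, abs_of_nonneg (by positivity), norm_mul, Complex.norm_real,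
    Real.norm_eq_abs, abs_of_nonneg (by positivity), mul_pow]
  have h1 : Real.cosh (μ * t) ^ M ≤ Real.exp (M * |μ| * |t|) := by
    calc Real.cosh (μ * t) ^ M ≤ Real.exp |μ * t| ^ M :=
          pow_le_pow_left₀ hcosh.le (cosh_le_exp_abs _) M
      _ = Real.exp (M * |μ| * |t|) := by rw [← Real.exp_nat_mul, abs_mul]; ring_nf
  calc ‖F t‖ * (2 ^ M * Real.cosh (μ * t) ^ M) * Real.exp (c * |t|)
      = 2 ^ M * (‖F t‖ * (Real.cosh (μ * t) ^ M * Real.exp (c * |t|))) := by ring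
    _ ≤ 2 ^ M * (‖F t‖ * (Real.exp (M * |μ| * |t|) * Real.exp (c * |t|))) := by gcongr
    _ = 2 ^ M * (‖F t‖ * Real.exp ((M * |μ| + c) * |t|)) := by rw [← Real.exp_add]; ring_nf

/-- **de Bruijn's shift identity** ((2.3) with `N = 1` applied under the integral sign):
`f(z + iμ) + f(z − iμ) = ∫ F(t) · 2cosh(μt) · e^{izt} dt` for `f = ∫ F(t) e^{izt} dt`.
[cite: Bruijn1950, Thm. 11] -/
theorem trigIntegral_shift_add (hFm : AEStronglyMeasurable F)
    (hexp : ∀ c : ℝ, Integrable fun t ↦ ‖F t‖ * Real.exp (c * |t|)) (μ : ℝ) (z : ℂ) :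
    trigIntegral F (z + I * μ) + trigIntegral F (z - I * μ) =
      trigIntegral (fun t ↦ F t * ((2 * Real.cosh (μ * t) : ℝ) : ℂ)) z := by
  simp only [trigIntegral]
  rw [← integral_add (integrable_mul_cexp_of_exp_moment hFm _ (hexp _))
    (integrable_mul_cexp_of_exp_moment hFm _ (hexp _))]
  refine integral_congr_ae (Eventually.of_forall fun t ↦ ?_)
  simp only [Complex.ofReal_mul, Complex.ofReal_ofNat, Complex.ofReal_cosh, Complex.cosh]
  have h1 : Complex.exp (I * (z + I * μ) * t) = Complex.exp (I * z * t) * Complex.exp (-(μ * t)) := by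
    rw [← Complex.exp_add]; congr 1; ring_nf; rw [Complex.I_sq]; ring
  have h2 : Complex.exp (I * (z - I * μ) * t) = Complex.exp (I * z * t) * Complex.exp (μ * t) := by
    rw [← Complex.exp_add]; congr 1; ring_nf; rw [Complex.I_sq]; ring
  rw [h1, h2]
  ring

/-- **Iterated shift identity** (de Bruijn's `S(t) = (2cosh μt)^M` as a universal factor,
Thms. 11–12 with `Δ = 0`): the `M`-fold iterate of `g ↦ g(· + iμ) + g(· − iμ)` applied to
`f = ∫ F(t) e^{izt} dt` is `∫ F(t) (2cosh μt)^M e^{izt} dt`. [cite: Bruijn1950, Thm. 12] -/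
theorem iterate_shift_trigIntegral (hFm : AEStronglyMeasurable F)
    (hexp : ∀ c : ℝ, Integrable fun t ↦ ‖F t‖ * Real.exp (c * |t|)) (μ : ℝ) (M : ℕ) :
    (fun g : ℂ → ℂ ↦ fun z ↦ g (z + I * μ) + g (z - I * μ))^[M] (trigIntegral F) =
      trigIntegral (fun t ↦ F t * (((2 * Real.cosh (μ * t)) ^ M : ℝ) : ℂ)) := by
  induction M generalizing F with
  | zero => simp
  | succ M ih =>
    rw [Function.iterate_succ_apply]
    have hstep : (fun z ↦ trigIntegral F (z + I * μ) + trigIntegral F (z - I * μ)) =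
        trigIntegral (fun t ↦ F t * ((2 * Real.cosh (μ * t) : ℝ) : ℂ)) :=
      funext fun z ↦ trigIntegral_shift_add hFm hexp μ z
    rw [hstep]
    have hFm' : AEStronglyMeasurable fun t ↦ F t * ((2 * Real.cosh (μ * t) : ℝ) : ℂ) :=
      hFm.mul (by fun_prop)
    have hexp' : ∀ c : ℝ, Integrable fun t ↦
        ‖F t * ((2 * Real.cosh (μ * t) : ℝ) : ℂ)‖ * Real.exp (c * |t|) := by
      simpa using integrable_norm_mul_pow_cosh_mul_exp hFm hexp μ 1
    rw [ih hFm' hexp']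
    congr 1
    funext t
    push_cast
    ring

/-- Pulling out the factor `2^M`: `∫ F (2cosh μt)^M e^{izt} = 2^M ∫ F (cosh μt)^M e^{izt}`. [folklore] -/
theorem trigIntegral_mul_pow_two_cosh (F : ℝ → ℂ) (μ : ℝ) (M : ℕ) (z : ℂ) :
    trigIntegral (fun t ↦ F t * (((2 * Real.cosh (μ * t)) ^ M : ℝ) : ℂ)) z =
      (2 : ℂ) ^ M * trigIntegral (fun t ↦ F t * ((Real.cosh (μ * t) ^ M : ℝ) : ℂ)) z := by
  simp only [trigIntegral, ← integral_const_mul]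
  refine integral_congr_ae (Eventually.of_forall fun t ↦ ?_)
  push_cast
  ring

/-! ## `cosh(x/N)^{N²} → e^{x²/2}` -/

/-- `1 + x²/2 ≤ cosh x` (first two terms of the power series). [folklore] -/
theorem one_add_sq_div_two_le_cosh (x : ℝ) : 1 + x ^ 2 / 2 ≤ Real.cosh x := by
  have h := sum_le_hasSum (Finset.range 2)
    (fun n _ ↦ div_nonneg (by rw [pow_mul]; positivity) (Nat.cast_nonneg _)) (Real.hasSum_cosh x)
  simpa [Finset.sum_range_succ, Nat.factorial] using h

/-- The domination `cosh(x/N)^{N²} ≤ e^{x²/2}` (from `cosh y ≤ e^{y²/2}`). [cite: Bruijn1950, eq. (3.9)] -/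
theorem cosh_div_pow_sq_le (x : ℝ) (N : ℕ) :
    Real.cosh (x / N) ^ (N ^ 2) ≤ Real.exp (x ^ 2 / 2) := by
  rcases Nat.eq_zero_or_pos N with rfl | hN
  · simp [Real.one_le_exp (by positivity : (0:ℝ) ≤ x ^ 2 / 2)]
  have hN' : (N : ℝ) ≠ 0 := by exact_mod_cast hN.ne'
  calc Real.cosh (x / N) ^ (N ^ 2) ≤ Real.exp ((x / N) ^ 2 / 2) ^ (N ^ 2) :=
        pow_le_pow_left₀ (Real.cosh_pos _).le (Real.cosh_le_exp_half_sq _) _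
    _ = Real.exp (x ^ 2 / 2) := by
        rw [← Real.exp_nat_mul]
        congr 1
        push_cast
        field_simp

/-- **`cosh(x/N)^{N²} → e^{x²/2}`** as `N → ∞` (squeezed between `(1 + x²/(2N²))^{N²}` and
`e^{x²/2}`). [cite: Bruijn1950, eq. (3.9)] -/
theorem tendsto_cosh_div_pow_sq (x : ℝ) :
    Tendsto (fun N : ℕ ↦ Real.cosh (x / N) ^ (N ^ 2)) atTop (𝓝 (Real.exp (x ^ 2 / 2))) := by
  have hlow : Tendsto (fun N : ℕ ↦ (1 + (x ^ 2 / 2) / ((N ^ 2 : ℕ) : ℝ)) ^ (N ^ 2)) atTop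
      (𝓝 (Real.exp (x ^ 2 / 2))) :=
    (Real.tendsto_one_add_div_pow_exp (x ^ 2 / 2)).comp (tendsto_pow_atTop two_ne_zero)
  refine tendsto_of_tendsto_of_tendsto_of_le_of_le' hlow tendsto_const_nhds ?_
    (Eventually.of_forall fun N ↦ cosh_div_pow_sq_le x N)
  filter_upwards [eventually_ge_atTop 1] with N hN
  have hN' : (0 : ℝ) < N := by exact_mod_cast hN
  have h1 : 1 + (x ^ 2 / 2) / ((N ^ 2 : ℕ) : ℝ) = 1 + (x / N) ^ 2 / 2 := by
    push_cast; field_simp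
  rw [h1]
  exact pow_le_pow_left₀ (by positivity) (one_add_sq_div_two_le_cosh _) _

/-! ## Locally uniform convergence of trigonometric integrals -/

/-- Exponential moments of a dominated kernel `F · k`, `|k| ≤ K`. [folklore] -/
theorem integrable_norm_mul_mul_exp_of_le (hFm : AEStronglyMeasurable F) {k K : ℝ → ℝ}
    (hk : Continuous k) (hkK : ∀ t, |k t| ≤ K t)
    (hmom : ∀ c : ℝ, Integrable fun t ↦ ‖F t‖ * (K t * Real.exp (c * |t|))) (c : ℝ) :
    Integrable fun t : ℝ ↦ ‖F t * (k t : ℂ)‖ * Real.exp (c * |t|) := by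
  refine (hmom c).mono' ((hFm.mul (by fun_prop)).norm.mul (by fun_prop))
    (Eventually.of_forall fun t ↦ ?_)
  rw [Real.norm_eq_abs, abs_of_nonneg (by positivity), norm_mul, Complex.norm_real,
    Real.norm_eq_abs, mul_assoc]
  gcongr
  exact hkK t

/-- The trigonometric integral of a dominated kernel is entire. [folklore] -/
theorem differentiable_trigIntegral_mul (hFm : AEStronglyMeasurable F) {k K : ℝ → ℝ}
    (hk : Continuous k) (hkK : ∀ t, |k t| ≤ K t)
    (hmom : ∀ c : ℝ, Integrable fun t ↦ ‖F t‖ * (K t * Real.exp (c * |t|))) :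
    Differentiable ℂ (trigIntegral fun t ↦ F t * (k t : ℂ)) :=
  differentiable_trigIntegral (hFm.mul (by fun_prop))
    (integrable_norm_mul_mul_exp_of_le hFm hk hkK hmom)

/-- Uniform bound on a horizontal strip: for `|Im z| ≤ Y`,
`‖∫ F k e^{izt} − ∫ F K e^{izt}‖ ≤ ∫ ‖F‖ |k − K| e^{Y|t|}`. [folklore] -/
theorem norm_trigIntegral_sub_le (hFm : AEStronglyMeasurable F) {k K : ℝ → ℝ}
    (hk : Continuous k) (hK : Continuous K) (hkK : ∀ t, |k t| ≤ K t)
    (hmom : ∀ c : ℝ, Integrable fun t ↦ ‖F t‖ * (K t * Real.exp (c * |t|))) {Y : ℝ} {z : ℂ}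
    (hz : |z.im| ≤ Y) :
    ‖trigIntegral (fun t ↦ F t * (k t : ℂ)) z - trigIntegral (fun t ↦ F t * (K t : ℂ)) z‖ ≤
      ∫ t : ℝ, ‖F t‖ * |k t - K t| * Real.exp (Y * |t|) := by
  have hKK : ∀ t, |K t| ≤ K t := fun t ↦ by
    rw [abs_of_nonneg ((abs_nonneg _).trans (hkK t))]
  have hik : Integrable fun t : ℝ ↦ F t * (k t : ℂ) * Complex.exp (I * z * t) :=
    integrable_mul_cexp_of_exp_moment (hFm.mul (by fun_prop)) z
      (integrable_norm_mul_mul_exp_of_le hFm hk hkK hmom ‖z‖)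
  have hiK : Integrable fun t : ℝ ↦ F t * (K t : ℂ) * Complex.exp (I * z * t) :=
    integrable_mul_cexp_of_exp_moment (hFm.mul (by fun_prop)) z
      (integrable_norm_mul_mul_exp_of_le hFm hK hKK hmom ‖z‖)
  simp only [trigIntegral]
  rw [← integral_sub hik hiK]
  refine norm_integral_le_of_norm_le ((hmom Y).const_mul 2 |>.mono' ?_ ?_) ?_
  · exact ((hFm.norm.mul (by fun_prop)).mul (by fun_prop))
  · refine Eventually.of_forall fun t ↦ ?_
    rw [Real.norm_eq_abs, abs_of_nonneg (by positivity)]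
    have h1 : |k t - K t| ≤ 2 * K t := by
      calc |k t - K t| ≤ |k t| + |K t| := abs_sub _ _
        _ ≤ K t + K t := add_le_add (hkK t) (hKK t)
        _ = 2 * K t := by ring
    calc ‖F t‖ * |k t - K t| * Real.exp (Y * |t|) ≤ ‖F t‖ * (2 * K t) * Real.exp (Y * |t|) := by
          gcongr
      _ = 2 * (‖F t‖ * (K t * Real.exp (Y * |t|))) := by ring
  · refine Eventually.of_forall fun t ↦ ?_
    rw [← sub_mul, ← mul_sub, norm_mul, norm_mul, ← Complex.ofReal_sub, Complex.norm_real,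
      Real.norm_eq_abs]
    gcongr
    calc ‖Complex.exp (I * z * t)‖ ≤ Real.exp (|z.im| * |t|) := by
          rw [Complex.norm_exp]
          apply Real.exp_le_exp.2
          have : (I * z * (t : ℂ)).re = -(z.im * t) := by simp [Complex.mul_re, Complex.mul_im]
          rw [this, ← abs_mul]
          exact neg_le_abs _
      _ ≤ Real.exp (Y * |t|) := Real.exp_le_exp.2 (mul_le_mul_of_nonneg_right hz (abs_nonneg t))

/-- **Dominated convergence of kernels gives locally uniform convergence of the trigonometric
integrals** (de Bruijn 1950, proof of Thm. 13: "`g_n → g` uniformly in any bounded region").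
If `k_n → K` pointwise with `|k_n| ≤ K` and `∫ ‖F‖ K e^{c|t|} < ∞` for all `c`, then
`∫ F k_n e^{izt} dt → ∫ F K e^{izt} dt` locally uniformly on `ℂ`. [cite: Bruijn1950, Thm. 13] -/
theorem tendstoLocallyUniformly_trigIntegral (hFm : AEStronglyMeasurable F) {k : ℕ → ℝ → ℝ}
    {K : ℝ → ℝ} (hk : ∀ n, Continuous (k n)) (hK : Continuous K) (hkK : ∀ n t, |k n t| ≤ K t)
    (hlim : ∀ t, Tendsto (fun n ↦ k n t) atTop (𝓝 (K t)))
    (hmom : ∀ c : ℝ, Integrable fun t ↦ ‖F t‖ * (K t * Real.exp (c * |t|))) :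
    TendstoLocallyUniformly (fun n ↦ trigIntegral fun t ↦ F t * (k n t : ℂ))
      (trigIntegral fun t ↦ F t * (K t : ℂ)) atTop := by
  -- the error integrals `δ_n(Y) = ∫ ‖F‖ |k_n − K| e^{Y|t|} → 0`
  have hδ : ∀ Y : ℝ, Tendsto (fun n ↦ ∫ t : ℝ, ‖F t‖ * |k n t - K t| * Real.exp (Y * |t|))
      atTop (𝓝 0) := by
    intro Y
    have h := tendsto_integral_of_dominated_convergence
      (fun t ↦ 2 * (‖F t‖ * (K t * Real.exp (Y * |t|))))
      (F := fun n t ↦ ‖F t‖ * |k n t - K t| * Real.exp (Y * |t|)) (f := fun _ ↦ (0 : ℝ))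
      (μ := volume) (fun n ↦ (hFm.norm.mul (by fun_prop)).mul (by fun_prop))
      ((hmom Y).const_mul 2) (fun n ↦ Eventually.of_forall fun t ↦ ?_)
      (Eventually.of_forall fun t ↦ ?_)
    · simpa using h
    · have hKK : |K t| ≤ K t := by rw [abs_of_nonneg ((abs_nonneg _).trans (hkK n t))]
      rw [Real.norm_eq_abs, abs_of_nonneg (by positivity)]
      have h1 : |k n t - K t| ≤ 2 * K t := by
        calc |k n t - K t| ≤ |k n t| + |K t| := abs_sub _ _
          _ ≤ K t + K t := add_le_add (hkK n t) hKK
          _ = 2 * K t := by ring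
      calc ‖F t‖ * |k n t - K t| * Real.exp (Y * |t|)
          ≤ ‖F t‖ * (2 * K t) * Real.exp (Y * |t|) := by gcongr
        _ = 2 * (‖F t‖ * (K t * Real.exp (Y * |t|))) := by ring
    · have h1 : Tendsto (fun n ↦ k n t - K t) atTop (𝓝 0) := by
        simpa using (hlim t).sub_const (K t)
      have h2 : Tendsto (fun n ↦ ‖F t‖ * |k n t - K t| * Real.exp (Y * |t|)) atTop
          (𝓝 (‖F t‖ * |(0 : ℝ)| * Real.exp (Y * |t|))) :=
        ((continuous_abs.tendsto 0).comp h1 |>.const_mul ‖F t‖).mul_const _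
      simpa using h2
  rw [Metric.tendstoLocallyUniformly_iff]
  intro ε hε z₀
  refine ⟨ball z₀ 1, ball_mem_nhds z₀ one_pos, ?_⟩
  filter_upwards [(hδ (|z₀.im| + 1)).eventually_lt_const hε] with n hn z hz
  rw [dist_comm, dist_eq_norm]
  refine (norm_trigIntegral_sub_le hFm (hk n) hK (hkK n) hmom ?_).trans_lt hn
  have h1 : |z.im - z₀.im| ≤ ‖z - z₀‖ := by
    simpa using Complex.abs_im_le_norm (z - z₀)
  have h2 : ‖z - z₀‖ < 1 := mem_ball_iff_norm.1 hz
  have h3 : |z.im| ≤ |z.im - z₀.im| + |z₀.im| := by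
    simpa using abs_add_le (z.im - z₀.im) z₀.im
  linarith

/-! ## de Bruijn's Theorem 13 for `Δ = 0` -/

/-- **de Bruijn 1950, Thm. 13, case `Δ = 0`** (with the target function assumed `≢ 0`).
Let `F` be admissible (Thm. 10) and suppose `f(z) = ∫ F(t) e^{izt} dt` has only real zeros.
Then `g(z) = ∫ F(t) e^{λ²t²/2} e^{izt} dt`, if not identically zero, has only real zeros.
Proof (de Bruijn): `g_N(z) = ∫ F(t) cosh(λt/N)^{N²} e^{izt} dt = 2^{-N²} (T_{λ/N})^{N²} f` has only
real zeros or vanishes identically (`Literature.Analysis.Complex.deBruijn_iterate_shift_dichotomy`, replacing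
de Bruijn's Thm. 8), `g_N → g` locally uniformly (`cosh(λt/N)^{N²} → e^{λ²t²/2}` dominatedly),
and Hurwitz's theorem (`Literature.Analysis.Complex.rootsInStrip_of_tendstoLocallyUniformly`). [cite: Bruijn1950, Thm. 13] -/
theorem rootsInStrip_zero_gaussian (hF : IsAdmissible F) (lam : ℝ)
    (hroots : RootsInStrip (trigIntegral F) 0)
    (hne : ∃ z, trigIntegral (fun t ↦ F t * (Real.exp (lam ^ 2 * t ^ 2 / 2) : ℝ)) z ≠ 0) :
    RootsInStrip (trigIntegral fun t ↦ F t * (Real.exp (lam ^ 2 * t ^ 2 / 2) : ℝ)) 0 := by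
  have hFm : AEStronglyMeasurable F := hF.integrable.aestronglyMeasurable
  have hexp := hF.integrable_norm_mul_exp
  -- the kernels
  set k : ℕ → ℝ → ℝ := fun N t ↦ Real.cosh (lam * t / N) ^ (N ^ 2) with hk
  set K : ℝ → ℝ := fun t ↦ Real.exp (lam ^ 2 * t ^ 2 / 2) with hK
  have hkc : ∀ N, Continuous (k N) := fun N ↦ by simp only [hk]; fun_prop
  have hKc : Continuous K := by simp only [hK]; fun_prop
  have hkK : ∀ N t, |k N t| ≤ K t := fun N t ↦ by
    simp only [hk, hK]
    rw [abs_of_nonneg (pow_nonneg (Real.cosh_pos _).le _)]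
    have := cosh_div_pow_sq_le (lam * t) N
    rwa [show (lam * t) ^ 2 / 2 = lam ^ 2 * t ^ 2 / 2 by ring] at this
  have hlim : ∀ t, Tendsto (fun N ↦ k N t) atTop (𝓝 (K t)) := fun t ↦ by
    simp only [hk, hK]
    have := tendsto_cosh_div_pow_sq (lam * t)
    rwa [show (lam * t) ^ 2 / 2 = lam ^ 2 * t ^ 2 / 2 by ring] at this
  have hmom : ∀ c : ℝ, Integrable fun t ↦ ‖F t‖ * (K t * Real.exp (c * |t|)) := fun c ↦ by
    have e : (fun t ↦ ‖F t‖ * (K t * Real.exp (c * |t|))) =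
        fun t ↦ ‖F t‖ * (Real.exp (lam ^ 2 / 2 * t ^ 2) * Real.exp (c * |t|)) := by
      funext t; simp only [hK]; congr 3; ring
    rw [e]
    exact hF.integrable_norm_mul_gaussian (lam ^ 2 / 2) c
  -- `g_N → g` locally uniformly
  have hconv := tendstoLocallyUniformly_trigIntegral hFm hkc hKc hkK hlim hmom
  -- the function `f` and its properties
  have hfd : Differentiable ℂ (trigIntegral F) := differentiable_trigIntegral hFm hexp
  obtain ⟨ρ, C₀, hρ0, hρ, hgr⟩ := hF.exists_order_bound
  have hreal : ∀ x : ℝ, (trigIntegral F x).im = 0 := isRealOnReal_trigIntegral hF.conj_symm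
  have hzero : ∀ z, trigIntegral F z = 0 → z.im = 0 := (rootsInStrip_zero_iff _).1 hroots
  -- `g_N = 2^{-N²} T^{N²} f`
  have hgN : ∀ N : ℕ, 0 < N → ∀ z,
      ((fun g : ℂ → ℂ ↦ fun z ↦ g (z + I * (lam / N : ℝ)) + g (z - I * (lam / N : ℝ)))^[N ^ 2]
        (trigIntegral F)) z = (2 : ℂ) ^ (N ^ 2) * trigIntegral (fun t ↦ F t * (k N t : ℂ)) z := by
    intro N hN z
    rw [iterate_shift_trigIntegral hFm hexp (lam / N) (N ^ 2), trigIntegral_mul_pow_two_cosh]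
    congr 3
    funext t
    simp only [hk]
    congr 3
    have hN' : (N : ℝ) ≠ 0 := by exact_mod_cast hN.ne'
    field_simp
  -- eventually `g_N(z₀) ≠ 0`
  obtain ⟨z₀, hz₀⟩ := hne
  have hK' : (fun t ↦ F t * (Real.exp (lam ^ 2 * t ^ 2 / 2) : ℝ)) = fun t ↦ F t * (K t : ℂ) := rfl
  rw [hK'] at hz₀ ⊢
  have hev0 : ∀ᶠ N : ℕ in atTop, trigIntegral (fun t ↦ F t * (k N t : ℂ)) z₀ ≠ 0 :=
    ((tendstoLocallyUniformlyOn_univ.2 hconv).tendsto_at (mem_univ z₀)).eventually_ne hz₀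
  -- eventually `g_N` has only real zeros
  have hevroots : ∀ᶠ N : ℕ in atTop, RootsInStrip (trigIntegral fun t ↦ F t * (k N t : ℂ)) 0 := by
    filter_upwards [hev0, eventually_gt_atTop 0] with N hN0 hNpos
    rw [rootsInStrip_zero_iff]
    have hdich := Literature.Analysis.Complex.deBruijn_iterate_shift_dichotomy hfd hρ0 hρ hgr hreal hzero
      (lam / N) (N ^ 2)
    have h2 : (2 : ℂ) ^ (N ^ 2) ≠ 0 := pow_ne_zero _ two_ne_zero
    rcases hdich with h0 | h1
    · exfalso
      apply hN0
      have := h0 z₀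
      rw [hgN N hNpos] at this
      exact (mul_eq_zero.1 this).resolve_left h2
    · intro z hz
      apply h1 z
      rw [hgN N hNpos, hz, mul_zero]
  have hevdiff : ∀ᶠ N : ℕ in atTop, Differentiable ℂ (trigIntegral fun t ↦ F t * (k N t : ℂ)) :=
    Eventually.of_forall fun N ↦ differentiable_trigIntegral_mul hFm (hkc N) (hkK N) hmom
  exact rootsInStrip_of_tendstoLocallyUniformly hevdiff hconv hevroots ⟨z₀, hz₀⟩

end DeBruijn1950

end Literature.Analysis.Complex
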